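/-
Copyright (c) 2026 the pub-hodgecm-mathlib formalisation cell (harness21).  Prover seat hodgecm-mathlib-K2E1-p09 (g3), Track B ∕ K2-LIT,
h413 = `stmt-HodgeConjecture-24833`, line `K2_E1_TraceFormulaBeta`, row 21 (DEAL E ∕ SQ5, part E-b): the REAL-QUADRATIC REGIME of the
ground-field change `L ⊆ L' = L(√d)` — complete splitting at `p` and row 21's transport with its hypotheses discharged.  2026-09-04.
-/
import Summits.HodgeConjecture.HodgeConjecture.Theorems.K2E1GroundFieldChangePlaceBijection   -- ★ p856572 (E-a): `cm_letter_transport_of_split_iff`, `under_complexConj_smul`, `eq_of_smul_eq`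
import Literature.NumberTheory.NumberFields.QuadraticExtensionDegreeOneSplitting             -- ★ Hensel at an odd place, «local square ⟹ split», `finitePlacesOver`
import HarnessLib

/-!
# h413 ∕ Track B «K2-LIT», line `K2_E1_TraceFormulaBeta`, row 21 (DEAL E ∕ SQ5, part E-b) — helper `K2E1TransportLetterRealQuadratic`:
# the regime `L' = L(√d)`, `d` a square at `𝔭`: complete splitting, (H0) + (D1) + matching, and the transport of the local letter

Cell `pub/hodgecm-mathlib`, crux H413 = `stmt-HodgeConjecture-24833`, route `HCCMUnconditional`; chair K2-lead (g0), dealer K2E1-plan (g2), DEAL E (SQ5)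
part (E-b), ruling «GO NOW» 2026-09-04T01:34:57Z ∕ 01:45:34Z.  THEOREMS ONLY (no `def`, no `instance`, no `notation`, no named-fact hypothesis, no `sorry`);
lane `--kind proof --supports stmt-HodgeConjecture-24833 --as helper` (count-neutral).

★ p856572 `K2E1GroundFieldChangePlaceBijection.cm_letter_transport_of_split_iff` transports row 21's local letter along a ground-field change of CM fields
`L ⊆ L'` at `𝔓 ∣ 𝔭` GIVEN (H0) `(w' ∩ 𝓞 L) ∩ 𝓞 L⁺ = 𝔭` for `w' ∣ 𝔓`, (D1) `e(w' | w' ∩ 𝓞 L) = f(w' | w' ∩ 𝓞 L) = 1`, and (MATCH) «`𝔓` split in `L'∕L'⁺` ⟺ `𝔭`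
split in `L∕L⁺`».  THIS FILE discharges all three in the REGIME of the line (dealer: presentation BY HYPOTHESES, any model, as ★ p854918):

THE SETTING.  CM number fields `L ⊆ L'` (`[Algebra L L']`, `[Algebra.IsQuadraticExtension L L']`), the tower of maximal real subfields given as
instances `[Algebra L⁺ L'⁺] [IsScalarTower L⁺ L'⁺ L']` (`L⁺ = maximalRealSubfield L`; the tower `L⁺ ⊆ L ⊆ L'` and `Algebra L⁺ L'` are Mathlib's
subfield instances); a REAL generator
`θ : L'⁺` with `(θ : L')² = d`, `d ∈ ℤ`, `θ ∉ L` (so `L' = L(√d)`, `L'⁺ = L⁺(√d)`); a finite place `𝔭` of `L⁺` at which `d` is a square in the completion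
`L⁺_𝔭` (`IsSquare (algebraMap L⁺ L⁺_𝔭 d)`, the tree's currency of `Literature/NumberTheory/NumberFields/AdicCompletionSquareCriteria.lean`); a place
`𝔓` of `L'⁺` with `𝔓 ∩ 𝓞 L⁺ = 𝔭`.  For an ODD prime `p ∈ 𝔭` and `d` a non-zero square modulo `p` (`p ∣ x² − d`, `p ∤ d`; row 21's `d ≡ 1 (mod 8p)` is `x = 1`)
the square hypothesis is HENSEL in `L⁺_𝔭` (★ `Literature.NumberTheory.NumberFields.isSquare_adicCompletion_intCast_of_sq_sub_dvd`) — no `ℚ_p ↔ L⁺_𝔭` bridge is needed.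

THE MATHEMATICS.
* §1 generic bookkeeping: at a completely split `v` (`v ∈ splitPrimes K E`) every `w ∣ v` has `e = f = 1`; squares go up along
  `ι_w : K_v → E_w` (★ `toPlace_coe`).
* §2 the tower: (H0) is `under_under` twice; **`𝔭` split in `L` ⟹ every `𝔓 ∣ 𝔭` split in `L'`** in general (a `c̄'`-fixed `w' ∣ 𝔓` restricts to a `c̄`-fixed
  place above `𝔭`, ★ `under_complexConj_smul`, contradicting the fibre-independence of the split token ★ `cm_smul_ne_iff_of_placesOver`);
  `[L'⁺ : L⁺] = 2` from `[L' : L⁺] = 2·2 = [L' : L'⁺]·[L'⁺ : L⁺]`; `θ ∉ L⁺`.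
* §3 the regime: `d ∈ (L⁺_𝔭)²` ⟹ TWO places of `L'⁺` above `𝔭` and, going up `ι_w`, `d ∈ (L_w)²` for every `w ∣ 𝔭`, so `w` splits completely in `L'`
  (★ `QuadraticExtension.ncard_finitePlacesOver_eq_two_of_isSquare`, ★ `QuadraticExtension.mem_splitPrimes_of_isSquare_adicCompletion`, O'Meara §65A) ⟹ (D1).
  **`𝔓` split ⟹ `𝔭` split**: otherwise `𝔭` has ONE place `w₀` of `L` above it, and `w'`, `c̄'⁻¹ w'` (both above `𝔓`) and any place above the second prime
  `𝔓₂ ≠ 𝔓` of `L'⁺` over `𝔭` are THREE distinct places of `L'` above `w₀` — but there are two.  Hence (MATCH), and ★ `cm_letter_transport_of_split_iff` ∕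
  ★ `exists_cmDatum_local_equiv_of_under` apply: **`cm_letter_transport_of_isSquare`**, `exists_cmDatum_local_equiv_of_isSquare`.
* §4 odd `p`: **`cm_letter_transport_realQuadratic`** (`p ∣ x² − d`, `p ∤ d`) and **`cm_letter_transport_realQuadratic_of_modEq`** (`d ≡ 1 [MOD 8 * p]`, the
  currency of ★ `K2E1SquarefreeOneModEightP` ∕ ★ `K2E1RealQuadraticSplitAtP`).

WHAT IS NOT HERE.  `p = 2` (the dyadic criterion `8 ∣ d − 1 ⟹ d ∈ (L⁺_𝔭)²` is not in the tree; §3 applies verbatim once it is); the ∃-construction of the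
model `L' = L(√d)` with its CM structure and real tower (`AdjoinRoot`, only if ever consumed); part (E-c) (letter transport at the level of
`E1St1383Letter`, PARKED of record).

HONEST LABEL.  Count-neutral helper; proves no printed statement; HC_CM is proved only modulo the 7 printed citations (2 remaining named inputs: hLiu418 =
`stmt-HodgeConjecture-24832`, h413 = `stmt-HodgeConjecture-24833`) until rung 0 closes.

## References
* [Omeara1963] O. T. O'Meara, *Introduction to Quadratic Forms* (1963), §63A (63:1a) (Hensel: unit residues are local squares), §65A (local squares split).
* [CasselsFrohlichANT1967] J. W. S. Cassels, A. Fröhlich (eds.), *Algebraic Number Theory* (1967), Ch. VII §1.1, Prop. 1.2 (ii); Ch. II §10.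
* [FrohlichTaylor1990] A. Fröhlich, M. Taylor, *Algebraic Number Theory* (1991), Ch. III §1 Thm. 20 (`(L:K) = Σ e f`).
* [Rogawski1990] J. Rogawski, *Automorphic representations of unitary groups in three variables* (1990), §14.2 p. 232 (context: the regime device `L ↦ L·K`).
-/

set_option autoImplicit false
set_option linter.dupNamespace false  -- the mandated namespace repeats the summit's segment (`HodgeConjecture.HodgeConjecture`)

noncomputable section

namespace Summit.HodgeConjecture.HodgeConjecture.Cruxes.H413.K2E1TransportLetterRealQuadratic

open NumberField IsDedekindDomain
open scoped Pointwise
open Literature.NumberTheory.Automorphic Literature.NumberTheory.Automorphic.UnitaryGroup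
open Literature.NumberTheory.QuadraticForms Literature.NumberTheory.GaloisRepresentations
open Summit.HodgeConjecture.HodgeConjecture.Cruxes.H413.K2E1GroundFieldChangeLocalRingIso
open Summit.HodgeConjecture.HodgeConjecture.Cruxes.H413.K2E1GroundFieldChangePlaceBijection

/-! ## §1 Generic bookkeeping for number fields `K ⊆ E` -/

section Generic

variable {K E : Type} [Field K] [NumberField K] [Field E] [NumberField E] [Algebra K E]

/-- **At a completely split `v` every `w ∣ v` is of degree one**: `v ∈ splitPrimes K E` (unramified, all residue degrees `1`) gives
`e(w|v) = f(w|v) = 1` for each place `w` of `E` with `w ∩ 𝓞 K = v` (Mathlib `Algebra.IsUnramifiedIn.ramificationIdx_eq_one`).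
[cite: FrohlichTaylor1990, Ch. III §1 Thm. 20] -/
theorem ramificationIdx_inertiaDeg_eq_one_of_mem_splitPrimes {v : HeightOneSpectrum (𝓞 K)} (hv : v ∈ splitPrimes K E)
    (w : HeightOneSpectrum (𝓞 E)) (hw : w.under (𝓞 K) = v) :
    w.asIdeal.ramificationIdx (𝓞 K) = 1 ∧ w.asIdeal.inertiaDeg (𝓞 K) = 1 := by
  subst hw
  have hlies : w.asIdeal.LiesOver (w.under (𝓞 K)).asIdeal := ⟨rfl⟩
  exact ⟨hv.1.ramificationIdx_eq_one hlies, hv.2 w.asIdeal ⟨w.isPrime, hlies⟩⟩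

/-- **Squares go up**: if `r ∈ K` is a square in `K_v` then it is a square in `E_w` for every `w ∣ v` (apply `ι_w : K_v → E_w`, ★ `toPlace_coe`). [folklore] -/
theorem isSquare_adicCompletion_of_isSquare_under (v : HeightOneSpectrum (𝓞 K)) (w : PlacesOver E v) (r : K)
    (h : IsSquare (algebraMap K (v.adicCompletion K) r)) :
    IsSquare (algebraMap E (w.1.adicCompletion E) (algebraMap K E r)) := by
  have h' := h.map (toPlace v w)
  rwa [show algebraMap K (v.adicCompletion K) r = (r : v.adicCompletion K) from rfl, toPlace_coe] at h'

end Generic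

/-! ## §2 The tower of a ground-field change of CM fields `L ⊆ L'` with its maximal real subfields -/

section Tower

variable (L L' : Type) [Field L] [NumberField L] [IsCMField L] [Field L'] [NumberField L'] [IsCMField L'] [Algebra L L']
  [Algebra ↥(maximalRealSubfield L) ↥(maximalRealSubfield L')] [IsScalarTower ↥(maximalRealSubfield L) ↥(maximalRealSubfield L') L']

omit [NumberField L] [IsCMField L] [NumberField L'] [IsCMField L'] in
/-- **(H0) for free**: if `𝔓 ∩ 𝓞 L⁺ = 𝔭` then `(w' ∩ 𝓞 L) ∩ 𝓞 L⁺ = 𝔭` for every `w' ∣ 𝔓` (both sides are `w' ∩ 𝓞 L⁺`, `under_under` in the two towers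
`L⁺ ⊆ L ⊆ L'` and `L⁺ ⊆ L'⁺ ⊆ L'`). [cite: CasselsFrohlichANT1967, Ch. VII §1.1] -/
theorem under_under_eq_of_under_eq (𝔭 : HeightOneSpectrum (𝓞 ↥(maximalRealSubfield L))) (𝔓 : HeightOneSpectrum (𝓞 ↥(maximalRealSubfield L')))
    (h𝔓 : 𝔓.under (𝓞 ↥(maximalRealSubfield L)) = 𝔭) (w' : PlacesOver L' 𝔓) :
    ((w'.1).under (𝓞 L)).under (𝓞 ↥(maximalRealSubfield L)) = 𝔭 := by
  have h1 : ((w'.1).under (𝓞 L)).under (𝓞 ↥(maximalRealSubfield L)) = (w'.1).under (𝓞 ↥(maximalRealSubfield L)) :=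
    HeightOneSpectrum.ext (Ideal.under_under (A := 𝓞 ↥(maximalRealSubfield L)) (B := 𝓞 L) (w'.1).asIdeal)
  have h2 : ((w'.1).under (𝓞 ↥(maximalRealSubfield L'))).under (𝓞 ↥(maximalRealSubfield L)) = (w'.1).under (𝓞 ↥(maximalRealSubfield L)) :=
    HeightOneSpectrum.ext (Ideal.under_under (A := 𝓞 ↥(maximalRealSubfield L)) (B := 𝓞 ↥(maximalRealSubfield L')) (w'.1).asIdeal)
  rw [h1, ← h2, w'.2, h𝔓]

/-- **`𝔭` split in `L∕L⁺` ⟹ every `𝔓 ∣ 𝔭` split in `L'∕L'⁺`** (for ANY ground-field change of CM fields): a `c̄'`-fixed place `w' ∣ 𝔓` would restrict to a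
`c̄`-fixed place of `L` above `𝔭` (★ `under_complexConj_smul`), while at a split `𝔭` every place above it is moved (★ `cm_smul_ne_iff_of_placesOver`).
[cite: CasselsFrohlichANT1967, Ch. VII Prop. 1.2 (ii)] -/
theorem smul_ne_of_exists_smul_ne_under (𝔭 : HeightOneSpectrum (𝓞 ↥(maximalRealSubfield L))) (𝔓 : HeightOneSpectrum (𝓞 ↥(maximalRealSubfield L')))
    (h𝔓 : 𝔓.under (𝓞 ↥(maximalRealSubfield L)) = 𝔭) (hsplit : ∃ w : PlacesOver L 𝔭, IsCMField.complexConj L • w.1 ≠ w.1) (w' : PlacesOver L' 𝔓) :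
    IsCMField.complexConj L' • w'.1 ≠ w'.1 := by
  intro heq
  obtain ⟨w, hw⟩ := hsplit
  let u : PlacesOver L 𝔭 := ⟨(w'.1).under (𝓞 L), under_under_eq_of_under_eq L L' 𝔭 𝔓 h𝔓 w'⟩
  have hu : IsCMField.complexConj L • u.1 = u.1 := by
    change IsCMField.complexConj L • (w'.1).under (𝓞 L) = (w'.1).under (𝓞 L)
    rw [← under_complexConj_smul L L' w'.1, heq]
  exact (K2E1InfinitelyManySplitPlaces.cm_smul_ne_iff_of_placesOver L w u).1 hw hu

/-- **`[L'⁺ : L⁺] = 2` when `[L' : L] = 2`**: `[L' : L⁺] = [L' : L]·[L : L⁺] = 4 = [L' : L'⁺]·[L'⁺ : L⁺] = 2·[L'⁺ : L⁺]`. [folklore] -/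
theorem finrank_maximalRealSubfield_eq_two [Algebra.IsQuadraticExtension L L'] :
    Module.finrank ↥(maximalRealSubfield L) ↥(maximalRealSubfield L') = 2 := by
  have h1 := Module.finrank_mul_finrank ↥(maximalRealSubfield L) L L'
  have h2 := Module.finrank_mul_finrank ↥(maximalRealSubfield L) ↥(maximalRealSubfield L') L'
  rw [Algebra.IsQuadraticExtension.finrank_eq_two ↥(maximalRealSubfield L) L, Algebra.IsQuadraticExtension.finrank_eq_two L L'] at h1
  rw [Algebra.IsQuadraticExtension.finrank_eq_two ↥(maximalRealSubfield L') L', ← h1] at h2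
  omega

/-- … so `L'⁺ ∕ L⁺` is a quadratic extension (as a `Prop`-valued structure, produced — not declared as an instance). [folklore] -/
theorem isQuadraticExtension_maximalRealSubfield [Algebra.IsQuadraticExtension L L'] :
    Algebra.IsQuadraticExtension ↥(maximalRealSubfield L) ↥(maximalRealSubfield L') :=
  { finrank_eq_two' := finrank_maximalRealSubfield_eq_two L L' }

omit [NumberField L] [IsCMField L] [NumberField L'] [IsCMField L'] in
/-- A real element of `L'` outside `L` is outside `L⁺`: `θ ∉ L ⟹ θ ∉ L⁺` (the towers `L⁺ ⊆ L'⁺ ⊆ L'` and `L⁺ ⊆ L ⊆ L'` agree). [folklore] -/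
theorem algebraMap_maximalRealSubfield_ne (θ : ↥(maximalRealSubfield L')) (hθL : ∀ r : L, algebraMap L L' r ≠ (θ : L'))
    (r : ↥(maximalRealSubfield L)) : algebraMap ↥(maximalRealSubfield L) ↥(maximalRealSubfield L') r ≠ θ := by
  intro h
  apply hθL (r : L)
  rw [show algebraMap L L' (r : L) = algebraMap ↥(maximalRealSubfield L) L' r from rfl,
    IsScalarTower.algebraMap_apply ↥(maximalRealSubfield L) ↥(maximalRealSubfield L') L' r, h]
  rfl

end Tower

/-! ## §3 The regime: `L' = L(θ)`, `θ` real, `θ² = d` a square in `L⁺_𝔭` -/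

section Regime

variable (L L' : Type) [Field L] [NumberField L] [IsCMField L] [Field L'] [NumberField L'] [IsCMField L'] [Algebra L L']
  [Algebra.IsQuadraticExtension L L']
  [Algebra ↥(maximalRealSubfield L) ↥(maximalRealSubfield L')] [IsScalarTower ↥(maximalRealSubfield L) ↥(maximalRealSubfield L') L']
  (d : ℤ) (θ : ↥(maximalRealSubfield L')) (hθ : ((θ : L') : L') ^ 2 = (d : L')) (hθL : ∀ r : L, algebraMap L L' r ≠ (θ : L'))
  (𝔭 : HeightOneSpectrum (𝓞 ↥(maximalRealSubfield L)))
  (hsq : IsSquare (algebraMap ↥(maximalRealSubfield L) (𝔭.adicCompletion ↥(maximalRealSubfield L)) (d : ↥(maximalRealSubfield L))))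

include hθ hθL hsq in
/-- **Two places of `L'⁺` above `𝔭`**: `L'⁺ = L⁺(θ)`, `θ² = d` a square in `L⁺_𝔭` (★ `QuadraticExtension.ncard_finitePlacesOver_eq_two_of_isSquare`, O'Meara §65A).
[cite: Omeara1963, §65A] -/
theorem ncard_finitePlacesOver_maximalRealSubfield_eq_two : (finitePlacesOver ↥(maximalRealSubfield L') 𝔭).ncard = 2 := by
  haveI := isQuadraticExtension_maximalRealSubfield L L'
  refine Literature.NumberTheory.QuadraticForms.QuadraticExtension.ncard_finitePlacesOver_eq_two_of_isSquare
    (K := ↥(maximalRealSubfield L)) (E := ↥(maximalRealSubfield L')) (θ := (d : ↥(maximalRealSubfield L))) (α := θ) ?_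
    (algebraMap_maximalRealSubfield_ne L L' θ hθL) 𝔭 hsq
  apply Subtype.ext
  rw [map_intCast]
  push_cast
  exact hθ

omit [IsCMField L] in
include hsq in
/-- `d` is a square in `L_w` for every `w ∣ 𝔭` (squares go up `ι_w : L⁺_𝔭 → L_w`). [folklore] -/
theorem isSquare_adicCompletion_of_placesOver (w : PlacesOver L 𝔭) : IsSquare (algebraMap L (w.1.adicCompletion L) (d : L)) := by
  have h := isSquare_adicCompletion_of_isSquare_under 𝔭 w (d : ↥(maximalRealSubfield L)) hsq
  rwa [map_intCast] at h

omit [IsCMField L] [IsCMField L'] [Algebra ↥(maximalRealSubfield L) ↥(maximalRealSubfield L')]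
  [IsScalarTower ↥(maximalRealSubfield L) ↥(maximalRealSubfield L') L'] in
include hθ hθL hsq in
/-- **Every `w ∣ 𝔭` splits completely in `L' = L(θ)`** (`θ² = d ∈ (L_w)²`; ★ `QuadraticExtension.mem_splitPrimes_of_isSquare_adicCompletion`). [cite: Omeara1963, §65A] -/
theorem mem_splitPrimes_of_placesOver (w : PlacesOver L 𝔭) : w.1 ∈ splitPrimes L L' :=
  Literature.NumberTheory.NumberFields.QuadraticExtension.mem_splitPrimes_of_isSquare_adicCompletion (K := L) (E := L') (θ := (d : L))
    (α := (θ : L')) (by rw [map_intCast]; exact hθ) hθL w.1 (isSquare_adicCompletion_of_placesOver L d 𝔭 hsq w)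

omit [IsCMField L] [IsCMField L'] [Algebra ↥(maximalRealSubfield L) ↥(maximalRealSubfield L')]
  [IsScalarTower ↥(maximalRealSubfield L) ↥(maximalRealSubfield L') L'] in
include hθ hθL hsq in
/-- … and has exactly TWO places of `L'` above it. [cite: Omeara1963, §65A] -/
theorem ncard_finitePlacesOver_eq_two_of_placesOver (w : PlacesOver L 𝔭) : (finitePlacesOver L' w.1).ncard = 2 :=
  Literature.NumberTheory.QuadraticForms.QuadraticExtension.ncard_finitePlacesOver_eq_two_of_isSquare (K := L) (E := L') (θ := (d : L))
    (α := (θ : L')) (by rw [map_intCast]; exact hθ) hθL w.1 (isSquare_adicCompletion_of_placesOver L d 𝔭 hsq w)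

omit [IsCMField L] [IsCMField L'] in
include hθ hθL hsq in
/-- **(D1) in the regime**: every place `w' ∣ 𝔓` of `L'`, `𝔓 ∣ 𝔭`, is of degree one over `w' ∩ 𝓞 L` (which lies above `𝔭` by (H0) and splits completely).
[cite: FrohlichTaylor1990, Ch. III §1 Thm. 20] -/
theorem ramificationIdx_inertiaDeg_eq_one (𝔓 : HeightOneSpectrum (𝓞 ↥(maximalRealSubfield L'))) (h𝔓 : 𝔓.under (𝓞 ↥(maximalRealSubfield L)) = 𝔭)
    (w' : PlacesOver L' 𝔓) : (w'.1).asIdeal.ramificationIdx (𝓞 L) = 1 ∧ (w'.1).asIdeal.inertiaDeg (𝓞 L) = 1 :=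
  ramificationIdx_inertiaDeg_eq_one_of_mem_splitPrimes
    (mem_splitPrimes_of_placesOver L L' d θ hθ hθL 𝔭 hsq ⟨(w'.1).under (𝓞 L), under_under_eq_of_under_eq L L' 𝔭 𝔓 h𝔓 w'⟩) w'.1 rfl

include hθ hθL hsq in
/-- **`𝔓` split in `L'∕L'⁺` ⟹ `𝔭` split in `L∕L⁺`** in the regime.  Otherwise `𝔭` has a unique place `w₀` of `L` above it (★ `eq_of_smul_eq`), and the
three places `w'`, `c̄'⁻¹ • w'` (above `𝔓`, distinct at a split `𝔓`) and any `w'' ∣ 𝔓₂` (for the second place `𝔓₂ ≠ 𝔓` of `L'⁺` above `𝔭`) of `L'` are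
pairwise distinct and all lie above `w₀` — contradicting «two places of `L'` above `w₀`». [cite: CasselsFrohlichANT1967, Ch. VII Prop. 1.2 (ii)]
[cite: FrohlichTaylor1990, Ch. III §1 Thm. 20] -/
theorem exists_smul_ne_under_of_exists_smul_ne (𝔓 : HeightOneSpectrum (𝓞 ↥(maximalRealSubfield L')))
    (h𝔓 : 𝔓.under (𝓞 ↥(maximalRealSubfield L)) = 𝔭) (hsplit' : ∃ w' : PlacesOver L' 𝔓, IsCMField.complexConj L' • w'.1 ≠ w'.1) :
    ∃ w : PlacesOver L 𝔭, IsCMField.complexConj L • w.1 ≠ w.1 := by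
  by_contra hns
  push Not at hns
  obtain ⟨w', hw'⟩ := hsplit'
  -- the unique place of `L` above `𝔭`
  let w₀ : PlacesOver L 𝔭 := ⟨(w'.1).under (𝓞 L), under_under_eq_of_under_eq L L' 𝔭 𝔓 h𝔓 w'⟩
  have huniq : ∀ u : PlacesOver L 𝔭, u = w₀ := fun u => eq_of_smul_eq L 𝔭 (hns w₀) u
  -- a second place `𝔓₂ ≠ 𝔓` of `L'⁺` above `𝔭`, and a place `w''` of `L'` above it
  obtain ⟨a, b, hab, hset⟩ := Set.ncard_eq_two.1 (ncard_finitePlacesOver_maximalRealSubfield_eq_two L L' d θ hθ hθL 𝔭 hsq)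
  have h𝔓mem : 𝔓 ∈ finitePlacesOver ↥(maximalRealSubfield L') 𝔭 := h𝔓
  obtain ⟨𝔓₂, h𝔓₂, hne⟩ : ∃ 𝔓₂ ∈ finitePlacesOver ↥(maximalRealSubfield L') 𝔭, 𝔓₂ ≠ 𝔓 := by
    rw [hset] at h𝔓mem ⊢
    rcases h𝔓mem with h | h
    · exact ⟨b, Or.inr rfl, fun e => hab (h.symm ▸ e.symm)⟩
    · exact ⟨a, Or.inl rfl, fun e => hab (e.trans h)⟩
  have h𝔓₂' : 𝔓₂.under (𝓞 ↥(maximalRealSubfield L)) = 𝔭 := h𝔓₂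
  obtain ⟨w''⟩ := (inferInstance : Nonempty (PlacesOver L' 𝔓₂))
  -- three pairwise distinct places of `L'` above `w₀`
  have h1 : w'.1 ∈ finitePlacesOver L' w₀.1 := rfl
  have h2 : (PlacesOver.galInv (IsCMField.complexConj L') w').1 ∈ finitePlacesOver L' w₀.1 := by
    change ((IsCMField.complexConj L')⁻¹ • w'.1).under (𝓞 L) = (w'.1).under (𝓞 L)
    rw [under_complexConj_inv_smul L L' w'.1]
    exact inv_smul_eq_iff.2 (hns w₀).symm
  have h3 : w''.1 ∈ finitePlacesOver L' w₀.1 :=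
    congrArg Subtype.val (huniq ⟨(w''.1).under (𝓞 L), under_under_eq_of_under_eq L L' 𝔭 𝔓₂ h𝔓₂' w''⟩)
  have h12 : w'.1 ≠ (PlacesOver.galInv (IsCMField.complexConj L') w').1 := fun e =>
    PlacesOver.galInv_ne (IsCMField.complexConj L') w' hw' (Subtype.ext e).symm
  have h13 : w'.1 ≠ w''.1 := fun e => hne (w''.2.symm.trans (e ▸ w'.2))
  have h23 : (PlacesOver.galInv (IsCMField.complexConj L') w').1 ≠ w''.1 := fun e =>
    hne (w''.2.symm.trans (e ▸ (PlacesOver.galInv (IsCMField.complexConj L') w').2))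
  have hsub : ({w'.1, (PlacesOver.galInv (IsCMField.complexConj L') w').1, w''.1} : Set (HeightOneSpectrum (𝓞 L'))) ⊆ finitePlacesOver L' w₀.1 := by
    intro z hz
    rcases hz with rfl | rfl | rfl
    exacts [h1, h2, h3]
  have h3card : ({w'.1, (PlacesOver.galInv (IsCMField.complexConj L') w').1, w''.1} : Set (HeightOneSpectrum (𝓞 L'))).ncard = 3 :=
    Set.ncard_eq_three.2 ⟨_, _, _, h12, h13, h23, rfl⟩
  have hle := Set.ncard_le_ncard hsub (finitePlacesOver_finite w₀.1)
  rw [h3card, ncard_finitePlacesOver_eq_two_of_placesOver L L' d θ hθ hθL 𝔭 hsq w₀] at hle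
  omega

include hθ hθL hsq in
/-- **(MATCH) in the regime**: `𝔓` splits in `L'∕L'⁺` iff `𝔭` splits in `L∕L⁺`. [cite: CasselsFrohlichANT1967, Ch. VII Prop. 1.2 (ii)] -/
theorem exists_smul_ne_iff (𝔓 : HeightOneSpectrum (𝓞 ↥(maximalRealSubfield L'))) (h𝔓 : 𝔓.under (𝓞 ↥(maximalRealSubfield L)) = 𝔭) :
    (∃ w' : PlacesOver L' 𝔓, IsCMField.complexConj L' • w'.1 ≠ w'.1) ↔ (∃ w : PlacesOver L 𝔭, IsCMField.complexConj L • w.1 ≠ w.1) := by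
  refine ⟨exists_smul_ne_under_of_exists_smul_ne L L' d θ hθ hθL 𝔭 hsq 𝔓 h𝔓, fun h => ?_⟩
  obtain ⟨w'⟩ := (inferInstance : Nonempty (PlacesOver L' 𝔓))
  exact ⟨w', smul_ne_of_exists_smul_ne_under L L' 𝔭 𝔓 h𝔓 h w'⟩

include hθ hθL hsq in
/-- **ROW 21's TRANSPORT IN THE REGIME `L' = L(√d)`, `d ∈ (L⁺_𝔭)²`** (★ `cm_letter_transport_of_split_iff` with (H0), (D1), (MATCH) discharged): for every place
`𝔓` of `L'⁺` above `𝔭` there are the restriction bijection `β : PlacesOver L' 𝔓 ≃ PlacesOver L 𝔭` and `e : U(H)(L⁺_𝔭) ≃ₜ* U(H ⊗ L')(L'⁺_𝔓)` along which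
★ `IrrClass.comap` is bijective, preserves admissibility, and matches `U(H)(𝒪_𝔓)`-spherical with `U(H)(𝒪_𝔭)`-spherical classes.
[cite: Rogawski1990, §14.2 p. 232] [cite: CasselsFrohlichANT1967, Ch. II §10, Ch. VII §1.1] -/
theorem cm_letter_transport_of_isSquare (N : ℕ) (H : Matrix (Fin N) (Fin N) L)
    (𝔓 : HeightOneSpectrum (𝓞 ↥(maximalRealSubfield L'))) (h𝔓 : 𝔓.under (𝓞 ↥(maximalRealSubfield L)) = 𝔭) :
    ∃ (β : PlacesOver L' 𝔓 ≃ PlacesOver L 𝔭) (e : (cmDatum L N H).Local 𝔭 ≃ₜ* (cmDatum L' N (H.map (algebraMap L L'))).Local 𝔓),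
      (∀ w' : PlacesOver L' 𝔓, (w'.1).under (𝓞 L) = (β w').1) ∧
      Function.Bijective (IrrClass.comap e) ∧
      (∀ κ : IrrClass ((cmDatum L' N (H.map (algebraMap L L'))).Local 𝔓), (IrrClass.comap e κ).IsAdmissible ↔ κ.IsAdmissible) ∧
      (∀ κ : IrrClass ((cmDatum L' N (H.map (algebraMap L L'))).Local 𝔓),
        (IrrClass.comap e κ).IsSpherical (cmLocalIntegralLevel L N H 𝔭) ↔
          κ.IsSpherical (cmLocalIntegralLevel L' N (H.map (algebraMap L L')) 𝔓)) :=
  cm_letter_transport_of_split_iff L L' N H 𝔭 𝔓 (under_under_eq_of_under_eq L L' 𝔭 𝔓 h𝔓)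
    (ramificationIdx_inertiaDeg_eq_one L L' d θ hθ hθL 𝔭 hsq 𝔓 h𝔓) (exists_smul_ne_iff L L' d θ hθ hθL 𝔭 hsq 𝔓 h𝔓)

include hθ hθL hsq in
/-- The same with the isomorphism of local data exposed (★ `exists_cmDatum_local_equiv_of_under` in the regime): `Φ : Π_{w ∣ 𝔭} L_w ≃+* Π_{w' ∣ 𝔓} L'_{w'}`,
`Φ x w' = ι_{w'∩L, w'}(x (w' ∩ 𝓞 L))`, and `e g = Φ(g)` entrywise, carrying `U(H)(𝒪_𝔭)` ONTO `U(H)(𝒪_𝔓)`. [cite: Rogawski1990, §14.2 p. 232]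
[cite: FrohlichTaylor1990, Ch. III §1 (1.14)(a)] -/
theorem exists_cmDatum_local_equiv_of_isSquare (N : ℕ) (H : Matrix (Fin N) (Fin N) L)
    (𝔓 : HeightOneSpectrum (𝓞 ↥(maximalRealSubfield L'))) (h𝔓 : 𝔓.under (𝓞 ↥(maximalRealSubfield L)) = 𝔭) :
    ∃ (β : PlacesOver L' 𝔓 ≃ PlacesOver L 𝔭) (hβ : ∀ w' : PlacesOver L' 𝔓, (w'.1).under (𝓞 L) = (β w').1)
      (Φ : LocalRing L 𝔭 ≃+* LocalRing L' 𝔓)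
      (e : «local» L (IsCMField.complexConj L) N H 𝔭 ≃ₜ* «local» L' (IsCMField.complexConj L') N (H.map (algebraMap L L')) 𝔓),
      (∀ (x : LocalRing L 𝔭) (w' : PlacesOver L' 𝔓), Φ x w' = toPlace (β w').1 (⟨w'.1, hβ w'⟩ : PlacesOver L' (β w').1) (x (β w'))) ∧
      (∀ g, ((e g : «local» L' (IsCMField.complexConj L') N (H.map (algebraMap L L')) 𝔓) : GL (Fin N) (LocalRing L' 𝔓)) =
        Matrix.GeneralLinearGroup.map (Φ : LocalRing L 𝔭 →+* LocalRing L' 𝔓) (g : GL (Fin N) (LocalRing L 𝔭))) ∧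
      (cmLocalIntegralLevel L N H 𝔭).map
          (e : «local» L (IsCMField.complexConj L) N H 𝔭 →* «local» L' (IsCMField.complexConj L') N (H.map (algebraMap L L')) 𝔓) =
        cmLocalIntegralLevel L' N (H.map (algebraMap L L')) 𝔓 := by
  obtain ⟨hinj, hsurj⟩ := injective_and_surjective_under_of_split_iff L L' 𝔭 𝔓 (under_under_eq_of_under_eq L L' 𝔭 𝔓 h𝔓)
    (exists_smul_ne_iff L L' d θ hθ hθL 𝔭 hsq 𝔓 h𝔓)
  exact exists_cmDatum_local_equiv_of_under L L' N H 𝔭 𝔓 (under_under_eq_of_under_eq L L' 𝔭 𝔓 h𝔓)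
    (ramificationIdx_inertiaDeg_eq_one L L' d θ hθ hθL 𝔭 hsq 𝔓 h𝔓) hinj hsurj

end Regime

/-! ## §4 Odd `p`: `d` a non-zero square modulo `p` (Hensel in `L⁺_𝔭`); the `d ≡ 1 (mod 8p)` currency of row 21 -/

section OddPrime

variable (L L' : Type) [Field L] [NumberField L] [IsCMField L] [Field L'] [NumberField L'] [IsCMField L'] [Algebra L L']
  [Algebra.IsQuadraticExtension L L']
  [Algebra ↥(maximalRealSubfield L) ↥(maximalRealSubfield L')] [IsScalarTower ↥(maximalRealSubfield L) ↥(maximalRealSubfield L') L']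
  (N : ℕ) (H : Matrix (Fin N) (Fin N) L)
  {p : ℕ} (hp : p.Prime) (hp2 : p ≠ 2)
  (𝔭 : HeightOneSpectrum (𝓞 ↥(maximalRealSubfield L))) (h𝔭p : (p : 𝓞 ↥(maximalRealSubfield L)) ∈ 𝔭.asIdeal)
  (𝔓 : HeightOneSpectrum (𝓞 ↥(maximalRealSubfield L'))) (h𝔓 : 𝔓.under (𝓞 ↥(maximalRealSubfield L)) = 𝔭)

include hp hp2 h𝔭p h𝔓 in
/-- **ROW 21's TRANSPORT FOR `L' = L(√d)`, `p` ODD, `d` A NON-ZERO SQUARE MOD `p`, `𝔭 ∋ p`, `𝔓 ∣ 𝔭`** (`d ∈ (L⁺_𝔭)²` by Hensel,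
★ `isSquare_adicCompletion_intCast_of_sq_sub_dvd`; then §3). [cite: Omeara1963, §63A (63:1a), §65A] [cite: Rogawski1990, §14.2 p. 232] -/
theorem cm_letter_transport_realQuadratic {d x : ℤ} (hx : (p : ℤ) ∣ x ^ 2 - d) (hpd : ¬ (p : ℤ) ∣ d)
    (θ : ↥(maximalRealSubfield L')) (hθ : ((θ : L') : L') ^ 2 = (d : L')) (hθL : ∀ r : L, algebraMap L L' r ≠ (θ : L')) :
    ∃ (β : PlacesOver L' 𝔓 ≃ PlacesOver L 𝔭) (e : (cmDatum L N H).Local 𝔭 ≃ₜ* (cmDatum L' N (H.map (algebraMap L L'))).Local 𝔓),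
      (∀ w' : PlacesOver L' 𝔓, (w'.1).under (𝓞 L) = (β w').1) ∧
      Function.Bijective (IrrClass.comap e) ∧
      (∀ κ : IrrClass ((cmDatum L' N (H.map (algebraMap L L'))).Local 𝔓), (IrrClass.comap e κ).IsAdmissible ↔ κ.IsAdmissible) ∧
      (∀ κ : IrrClass ((cmDatum L' N (H.map (algebraMap L L'))).Local 𝔓),
        (IrrClass.comap e κ).IsSpherical (cmLocalIntegralLevel L N H 𝔭) ↔
          κ.IsSpherical (cmLocalIntegralLevel L' N (H.map (algebraMap L L')) 𝔓)) :=
  cm_letter_transport_of_isSquare L L' d θ hθ hθL 𝔭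
    (Literature.NumberTheory.NumberFields.isSquare_adicCompletion_intCast_of_sq_sub_dvd 𝔭 hp hp2 h𝔭p hx hpd) N H 𝔓 h𝔓

include hp hp2 h𝔭p h𝔓 in
/-- **THE SAME IN ROW 21's CURRENCY `d ≡ 1 (mod 8p)`** (★ `K2E1SquarefreeOneModEightP` ∕ ★ `K2E1RealQuadraticSplitAtP`): `p ∣ 1² − d` and `p ∤ d`.
[cite: Omeara1963, §63A (63:1a), §65A] [cite: Rogawski1990, §14.2 p. 232] -/
theorem cm_letter_transport_realQuadratic_of_modEq {d : ℕ} (hmod : d ≡ 1 [MOD 8 * p])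
    (θ : ↥(maximalRealSubfield L')) (hθ : ((θ : L') : L') ^ 2 = (d : L')) (hθL : ∀ r : L, algebraMap L L' r ≠ (θ : L')) :
    ∃ (β : PlacesOver L' 𝔓 ≃ PlacesOver L 𝔭) (e : (cmDatum L N H).Local 𝔭 ≃ₜ* (cmDatum L' N (H.map (algebraMap L L'))).Local 𝔓),
      (∀ w' : PlacesOver L' 𝔓, (w'.1).under (𝓞 L) = (β w').1) ∧
      Function.Bijective (IrrClass.comap e) ∧
      (∀ κ : IrrClass ((cmDatum L' N (H.map (algebraMap L L'))).Local 𝔓), (IrrClass.comap e κ).IsAdmissible ↔ κ.IsAdmissible) ∧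
      (∀ κ : IrrClass ((cmDatum L' N (H.map (algebraMap L L'))).Local 𝔓),
        (IrrClass.comap e κ).IsSpherical (cmLocalIntegralLevel L N H 𝔭) ↔
          κ.IsSpherical (cmLocalIntegralLevel L' N (H.map (algebraMap L L')) 𝔓)) := by
  -- `8p ∣ d - 1`, so `p ∣ 1² - d` and `p ∤ d`
  have h8p : ((8 * p : ℕ) : ℤ) ∣ (d : ℤ) - (1 : ℕ) := Nat.modEq_iff_dvd.1 hmod.symm
  have h8 : (p : ℤ) ∣ ((8 * p : ℕ) : ℤ) := ⟨8, by push_cast; ring⟩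
  have hpd1 : (p : ℤ) ∣ (d : ℤ) - 1 := h8.trans (by exact_mod_cast h8p)
  have hx : (p : ℤ) ∣ (1 : ℤ) ^ 2 - (d : ℤ) := by
    rw [one_pow, ← dvd_neg, neg_sub]
    exact hpd1
  have hpd : ¬ (p : ℤ) ∣ (d : ℤ) := fun h => by
    have h1 : (p : ℤ) ∣ 1 := by
      have := dvd_sub h hpd1
      rwa [sub_sub_cancel] at this
    exact hp.not_dvd_one (by exact_mod_cast h1)
  have hθ' : ((θ : L') : L') ^ 2 = ((d : ℤ) : L') := by rw [hθ]; norm_cast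
  exact cm_letter_transport_realQuadratic L L' N H hp hp2 𝔭 h𝔭p 𝔓 h𝔓 hx hpd θ hθ' hθL

end OddPrime

end Summit.HodgeConjecture.HodgeConjecture.Cruxes.H413.K2E1TransportLetterRealQuadratic

end
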